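import Literature.Topology.FourManifolds.TwoGenericMapsExist
import Literature.Topology.FourManifolds.OneJetFoldDichotomy
import HarnessLib

/-!
# Generic maps of a closed 4-manifold to the plane: regular points, fold points, simple cusps

Topic `Literature/Topology/FourManifolds` (programme of the fact
`Literature.Topology.FourManifolds.exists_isSimplifiedBrokenLefschetzFibration`, Baykur–Saeki 2017, §2.1
p. 6: "The singularities of a generic map `f : X → Σ` [...] are *folds* and *cusps*").  This
file assembles the genericity theorems of the lane (`TwoGenericMapsExist.exists_twoGeneric_map`:
rank `≥ 1`, `j¹f ⋔ S₁`, cusp-generic at every point) with the pointwise fold/cusp dichotomy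
(`OneJetFoldDichotomy.exists_tangent_dichotomy`, Golubitsky–Guillemin VI (2.1)) into the
statement one quotes: **every compact boundaryless `C^∞` 4-manifold carries a `C^∞` map to `ℝ²`
each of whose points is, read in the chart at the point, a regular point, a fold point (rank-one
critical point with nondegenerate kernel Hessian — Golubitsky–Guillemin III Def. 4.1 / VI §1) or a
simple cusp candidate (rank one, the kernel Hessian has a one-dimensional radical `ℝ k₀`, the
critical curve is tangent to `k₀`, and Whitney's cubic `ℓ D³g(k₀,k₀,k₀) + 3τ μ D²g(k₀,k₀)` is
non-zero for every multiplier datum — GG VI Def. 2.3)** — `OneJet.exists_generic_map_trichotomy`.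
The local normal forms then follow from the fold-chart theorems of the lane
(`IntrinsicFoldCriterion.hasIndefiniteFoldChart_of_kerHessian` for indefinite folds) and, for
cusps, from Whitney's theorem (not formalised here).

* `OneJet.exists_multiplier` — at a cusp candidate a multiplier datum `(μ, τ)` exists;
* `OneJet.trichotomy_of_generic` — the pointwise trichotomy for a `C^∞` map on an open set of
  `ℝ⁴` that is of rank `≥ 1`, 1-jet-transverse and cusp-generic at the point;
* **`OneJet.exists_generic_map_trichotomy`** — the manifold statement.

Everything is proved; no definitions, no named facts (D-0026).

## References

* M. Golubitsky, V. Guillemin, *Stable Mappings and Their Singularities*, GTM 14 (1973), Ch. III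
  Def. 4.1; Ch. VI §1, §2 (2.1) and Def. 2.3, §5 Thm. 5.2. [GolubitskyGuillemin1973]
* R. İ. Baykur, O. Saeki, *Simplifying indefinite fibrations on 4-manifolds*, arXiv:1705.11169,
  §2.1 p. 6. [BaykurSaeki2017]
-/

noncomputable section

set_option maxSynthPendingDepth 2

open Set Function Filter
open scoped ContDiff Topology Manifold

namespace Literature.Topology.FourManifolds

namespace OneJet

section Local

/-- Local notation for this file: the model space `ℝⁿ = EuclideanSpace ℝ (Fin n)`. -/
local notation "𝔼 " n:arg => EuclideanSpace ℝ (Fin n)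

/-- **A multiplier datum exists at a cusp candidate.**  If `dg_x` has rank one (non-zero, not
onto) and the covector `v ↦ ℓ D²g(x)(v, k₀)` vanishes on `Ker dg_x`, then it is `-τ μ ∘ dg_x` for
some covector `μ` of the plane and `τ = 1`. [folklore] -/
theorem exists_multiplier {g : 𝔼 4 → 𝔼 2} {x : 𝔼 4} (hcrit : ¬ Surjective (fderiv ℝ g x))
    (hne : fderiv ℝ g x ≠ 0) {ℓ : (𝔼 2) →L[ℝ] ℝ} {k₀ : 𝔼 4}
    (hrad : ∀ k, fderiv ℝ g x k = 0 → ℓ (fderiv ℝ (fderiv ℝ g) x k k₀) = 0) :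
    ∃ (μ : (𝔼 2) →L[ℝ] ℝ) (τ : ℝ),
      ∀ v, ℓ (fderiv ℝ (fderiv ℝ g) x v k₀) = -(τ * μ (fderiv ℝ g x v)) := by
  -- a vector `e` with `m = dg e ≠ 0` and a covector `μ₀` with `μ₀ m = 1`
  have he : ∃ e, fderiv ℝ g x e ≠ 0 := by
    by_contra h
    push Not at h
    exact hne (ContinuousLinearMap.ext fun e => by simpa using h e)
  obtain ⟨e, he⟩ := he
  set m : 𝔼 2 := fderiv ℝ g x e with hm
  have hj : ∃ j : Fin 2, m j ≠ 0 := by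
    by_contra h
    push Not at h
    exact he (by ext j; simpa [hm] using h j)
  obtain ⟨j, hj⟩ := hj
  set μ₀ : (𝔼 2) →L[ℝ] ℝ := (m j)⁻¹ • (EuclideanSpace.proj j : (𝔼 2) →L[ℝ] ℝ) with hμ₀
  have hμ₀m : μ₀ m = 1 := by
    simp only [hμ₀, _root_.smul_apply, smul_eq_mul]
    rw [show (EuclideanSpace.proj j : (𝔼 2) →L[ℝ] ℝ) m = m j from rfl, inv_mul_cancel₀ hj]
  refine ⟨(-ℓ (fderiv ℝ (fderiv ℝ g) x e k₀)) • μ₀, 1, fun v => ?_⟩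
  -- `dg v = a • dg e`, so `v - a • e ∈ Ker dg`
  obtain ⟨a, ha⟩ := exists_eq_smul_of_not_surjective hcrit he v
  have hK : fderiv ℝ g x (v - a • e) = 0 := by rw [map_sub, map_smul, ha, ← hm, sub_self]
  have h1 := hrad _ hK
  rw [map_sub, map_smul, _root_.sub_apply, _root_.smul_apply,
    map_sub, map_smul, smul_eq_mul, sub_eq_zero] at h1
  rw [h1, ha, ← hm]
  simp only [_root_.smul_apply, map_smul, smul_eq_mul, hμ₀m]
  ring

/-- **The pointwise trichotomy of a generic map `ℝ⁴ ⊇ Ω → ℝ²`.**  Let `g` be `C^∞` on the open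
`Ω ∋ x`, with `dg_x ≠ 0`, 1-jet-transverse and cusp-generic at `x`.  Then `x` is a regular point,
or a **fold point** (a cokernel covector `ℓ ≠ 0` whose kernel Hessian `ℓ D²g(x)|_{Ker dg_x}` is
nondegenerate), or a **simple cusp candidate**: a cokernel covector `ℓ ≠ 0` and a non-zero
`k₀ ∈ Ker dg_x` spanning the radical of the kernel Hessian, to which the critical curve is
tangent (`{v | ℓ D²g(x)(v, Ker dg_x) = 0} = ℝ k₀`), a multiplier datum exists, and Whitney's
cubic is non-zero for every multiplier datum.
[cite: GolubitskyGuillemin1973, Ch. VI §2, (2.1) and Def. 2.3] -/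
theorem trichotomy_of_generic {g : 𝔼 4 → 𝔼 2} {Ω : Set (𝔼 4)} (hΩ : IsOpen Ω)
    (hg : ContDiffOn ℝ ∞ g Ω) {x : 𝔼 4} (hx : x ∈ Ω) (hne : fderiv ℝ g x ≠ 0)
    (htr : IsOneJetTransverseAt g x) (hcusp : IsCuspGenericAt g x) :
    Surjective (fderiv ℝ g x) ∨
    (∃ ℓ : (𝔼 2) →L[ℝ] ℝ, ℓ ≠ 0 ∧ ℓ.comp (fderiv ℝ g x) = 0 ∧
      ∀ k₀, fderiv ℝ g x k₀ = 0 →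
        (∀ k, fderiv ℝ g x k = 0 → ℓ (fderiv ℝ (fderiv ℝ g) x k k₀) = 0) → k₀ = 0) ∨
    (∃ ℓ : (𝔼 2) →L[ℝ] ℝ, ℓ ≠ 0 ∧ ℓ.comp (fderiv ℝ g x) = 0 ∧
      ∃ k₀ : 𝔼 4, k₀ ≠ 0 ∧ fderiv ℝ g x k₀ = 0 ∧
        (∀ k, fderiv ℝ g x k = 0 → ℓ (fderiv ℝ (fderiv ℝ g) x k k₀) = 0) ∧
        (∀ v, (∀ k, fderiv ℝ g x k = 0 → ℓ (fderiv ℝ (fderiv ℝ g) x v k) = 0) ↔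
          ∃ c : ℝ, v = c • k₀) ∧
        (∃ (μ : (𝔼 2) →L[ℝ] ℝ) (τ : ℝ),
          ∀ v, ℓ (fderiv ℝ (fderiv ℝ g) x v k₀) = -(τ * μ (fderiv ℝ g x v))) ∧
        ∀ (μ : (𝔼 2) →L[ℝ] ℝ) (τ : ℝ),
          (∀ v, ℓ (fderiv ℝ (fderiv ℝ g) x v k₀) = -(τ * μ (fderiv ℝ g x v))) →
            cubicForm g x ℓ μ k₀ τ ≠ 0) := by
  by_cases hcrit : Surjective (fderiv ℝ g x)
  · exact Or.inl hcrit
  obtain ⟨ℓ, hℓ, hℓg⟩ := exists_ne_zero_comp_eq_zero hcrit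
  obtain ⟨t₀, ht₀0, hline, hdich⟩ := exists_tangent_dichotomy hΩ hg hx hcrit hne htr hℓ hℓg
  by_cases hMt : fderiv ℝ g x t₀ = 0
  · -- cusp candidate with radical direction `t₀`
    have hsymm : IsSymmSndFDerivAt ℝ g x :=
      (hg.contDiffAt (hΩ.mem_nhds hx)).isSymmSndFDerivAt
        (by simp only [minSmoothness_of_isRCLikeNormedField]; exact CerfPath.two_le_infty)
    have ht₀T : ∀ k, fderiv ℝ g x k = 0 → ℓ (fderiv ℝ (fderiv ℝ g) x t₀ k) = 0 :=
      (hline t₀).2 ⟨1, by rw [one_smul]⟩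
    have hrad : ∀ k, fderiv ℝ g x k = 0 → ℓ (fderiv ℝ (fderiv ℝ g) x k t₀) = 0 := fun k hk => by
      rw [hsymm.eq k t₀]
      exact ht₀T k hk
    refine Or.inr (Or.inr ⟨ℓ, hℓ, hℓg, t₀, ht₀0, hMt, hrad, hline,
      exists_multiplier hcrit hne hrad, fun μ τ hrel => ?_⟩)
    exact hcusp ℓ hℓ hℓg t₀ ht₀0 hMt hrad μ τ hrel
  · -- fold point
    exact Or.inr (Or.inl ⟨ℓ, hℓ, hℓg, hdich.2 hMt⟩)

end Local

section Manifold

/-- Local notation for this file: the model space `ℝⁿ = EuclideanSpace ℝ (Fin n)`. -/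
local notation "𝔼 " n:arg => EuclideanSpace ℝ (Fin n)

/-- **Generic maps of a closed 4-manifold to the plane have only regular points, fold points and
simple cusp candidates** (Thom–Whitney genericity as used by Baykur–Saeki §2.1: "the
singularities of a generic map are folds and cusps").  On every compact boundaryless `C^∞`
manifold modelled on `ℝ⁴` there is a `C^∞` map `f : M → ℝ²` such that at every point `q`, for
the chart representative `g = f ∘ φ_q⁻¹` at `y = φ_q q`: `dg_y ≠ 0`, and `y` is a regular point
of `g`, or a fold point, or a simple cusp candidate (as in `OneJet.trichotomy_of_generic`).
[cite: BaykurSaeki2017, §2.1, p. 6]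
[cite: GolubitskyGuillemin1973, Ch. VI §1 Def. 1.5, §2 (2.1) and Def. 2.3, §5 Thm. 5.2] -/
theorem exists_generic_map_trichotomy (M : Type*) [TopologicalSpace M] [T2Space M]
    [CompactSpace M] [ChartedSpace (𝔼 4) M] [IsManifold (𝓡 4) ∞ M] :
    ∃ f : M → 𝔼 2, ContMDiff (𝓡 4) (𝓡 2) ∞ f ∧ ∀ q : M,
      fderiv ℝ (f ∘ (extChartAt (𝓡 4) q).symm) (extChartAt (𝓡 4) q q) ≠ 0 ∧
      (Surjective (fderiv ℝ (f ∘ (extChartAt (𝓡 4) q).symm) (extChartAt (𝓡 4) q q)) ∨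
      (∃ ℓ : (𝔼 2) →L[ℝ] ℝ, ℓ ≠ 0 ∧
        ℓ.comp (fderiv ℝ (f ∘ (extChartAt (𝓡 4) q).symm) (extChartAt (𝓡 4) q q)) = 0 ∧
        ∀ k₀, fderiv ℝ (f ∘ (extChartAt (𝓡 4) q).symm) (extChartAt (𝓡 4) q q) k₀ = 0 →
          (∀ k, fderiv ℝ (f ∘ (extChartAt (𝓡 4) q).symm) (extChartAt (𝓡 4) q q) k = 0 →
            ℓ (fderiv ℝ (fderiv ℝ (f ∘ (extChartAt (𝓡 4) q).symm)) (extChartAt (𝓡 4) q q)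
              k k₀) = 0) → k₀ = 0) ∨
      (∃ ℓ : (𝔼 2) →L[ℝ] ℝ, ℓ ≠ 0 ∧
        ℓ.comp (fderiv ℝ (f ∘ (extChartAt (𝓡 4) q).symm) (extChartAt (𝓡 4) q q)) = 0 ∧
        ∃ k₀ : 𝔼 4, k₀ ≠ 0 ∧
          fderiv ℝ (f ∘ (extChartAt (𝓡 4) q).symm) (extChartAt (𝓡 4) q q) k₀ = 0 ∧
          (∀ k, fderiv ℝ (f ∘ (extChartAt (𝓡 4) q).symm) (extChartAt (𝓡 4) q q) k = 0 →
            ℓ (fderiv ℝ (fderiv ℝ (f ∘ (extChartAt (𝓡 4) q).symm)) (extChartAt (𝓡 4) q q)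
              k k₀) = 0) ∧
          (∀ v, (∀ k, fderiv ℝ (f ∘ (extChartAt (𝓡 4) q).symm) (extChartAt (𝓡 4) q q) k = 0 →
              ℓ (fderiv ℝ (fderiv ℝ (f ∘ (extChartAt (𝓡 4) q).symm)) (extChartAt (𝓡 4) q q)
                v k) = 0) ↔ ∃ c : ℝ, v = c • k₀) ∧
          (∃ (μ : (𝔼 2) →L[ℝ] ℝ) (τ : ℝ), ∀ v,
            ℓ (fderiv ℝ (fderiv ℝ (f ∘ (extChartAt (𝓡 4) q).symm)) (extChartAt (𝓡 4) q q)
              v k₀) =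
              -(τ * μ (fderiv ℝ (f ∘ (extChartAt (𝓡 4) q).symm) (extChartAt (𝓡 4) q q) v))) ∧
          ∀ (μ : (𝔼 2) →L[ℝ] ℝ) (τ : ℝ),
            (∀ v, ℓ (fderiv ℝ (fderiv ℝ (f ∘ (extChartAt (𝓡 4) q).symm))
                (extChartAt (𝓡 4) q q) v k₀) =
              -(τ * μ (fderiv ℝ (f ∘ (extChartAt (𝓡 4) q).symm) (extChartAt (𝓡 4) q q) v))) →
            cubicForm (f ∘ (extChartAt (𝓡 4) q).symm) (extChartAt (𝓡 4) q q) ℓ μ k₀ τ ≠ 0)) := by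
  obtain ⟨f, hf, hgen⟩ := exists_twoGeneric_map M
  refine ⟨f, hf, fun q => ?_⟩
  obtain ⟨hne, htr, hcusp⟩ := hgen q
  exact ⟨hne, trichotomy_of_generic (isOpen_extChartAt_target q)
    (contDiffOn_comp_extChartAt_symm_target (I := 𝓡 4) hf q) (mem_extChartAt_target q)
    hne htr hcusp⟩

end Manifold

end OneJet

end Literature.Topology.FourManifolds
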